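import Mathlib

/-!
# Sketch — crux-ideate round 1 (ideator 1) for `HyperbolicRegulator.CurvatureUniformity`
(stmt-QuantumFields-15825)

Typed first lemmas of the two idea cards filed from this seat:

* §1 `logAnchor_beyond_cover` (card `log-anchor-absorbs-onset`): the vocabulary-free composition
  "log-quantitative anchor (rate `c/k` whenever `B log k + C ≤ β`) + ONE rate beyond the explicit
  crossover scale `θ·exp((β−C)/B)` ⇒ one rate for all `k ≥ 8`" — PROVED. It shows that with a
  log-quantitative anchor threshold the fixed-`k` onset statement `stub_uniformOnset` of
  `Lines/birth.lean` is not needed: the two `k`-ranges overlap by construction.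
* §2 `HarvestInequality` (card `dial-threshold-harvest`): the `L²` harvest inequality
  "variance of the conditional expectation on an exterior σ-algebra ≤ the worst covariance of `f`
  against a bounded exterior observable" — stated as a `Prop` over Mathlib's `condExp`
  (elaboration only; it is the first checkable statement of the harvest step: strong clustering of
  a state against the exterior σ-algebra ⇒ the boundary datum is TYPICALLY uninfluential, by
  Chebyshev).
* §3 `TypicalInsensitivity` : the Chebyshev form actually consumed by a typical-window engine.
-/

set_option autoImplicit false

namespace Summit.QuantumFields.YangMills.Cruxes.CurvatureUniformity.IdeateR1K1

/-! ## §1  Log-quantitative anchor + beyond-crossover rate ⇒ uniform rate (card B) -/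

/-- **Composition behind `log-anchor-absorbs-onset`.** `Clus k β m` is an abstract clustering
predicate ("at curvature scale `k` and coupling `β` the family clusters at rate `m`", the crux's
`∀ A B, Sp … → ∃ C j₀, ∀ j ≥ j₀, (Φ k j).2 β m C A B`), antitone in the rate. If the anchor holds
with a LOG-QUANTITATIVE threshold (`B log k + C ≤ β ⇒` rate `c/k`) and one rate `m(β)` serves every
`k ≥ θ·exp((β−C)/B)` (the explicit crossover scale, `0 < θ ≤ 1`), then one rate serves all `k ≥ 8`:
no separate fixed-`k` onset statement is needed. -/
theorem logAnchor_beyond_cover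
    (Clus : ℕ → ℝ → ℝ → Prop)
    (mono : ∀ (k : ℕ) (β m m' : ℝ), m' ≤ m → Clus k β m → Clus k β m')
    (B C c θ β₁ : ℝ) (hB : 0 < B) (hc : 0 < c) (hθ1 : θ ≤ 1)
    (anchor : ∀ k : ℕ, 8 ≤ k → ∀ β : ℝ, B * Real.log k + C ≤ β → Clus k β (c / k))
    (beyond : ∀ β : ℝ, β₁ ≤ β → ∃ m : ℝ, 0 < m ∧
      ∀ k : ℕ, 8 ≤ k → θ * Real.exp ((β - C) / B) ≤ k → Clus k β m) :
    ∀ β : ℝ, β₁ ≤ β → ∃ m : ℝ, 0 < m ∧ ∀ k : ℕ, 8 ≤ k → Clus k β m := by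
  intro β hβ
  obtain ⟨m, hm, hbey⟩ := beyond β hβ
  set ks : ℝ := Real.exp ((β - C) / B) with hks
  have hks0 : 0 < ks := Real.exp_pos _
  refine ⟨min m (c / ks), lt_min hm (div_pos hc hks0), ?_⟩
  intro k hk
  have hk0 : (0 : ℝ) < k := by exact_mod_cast (show 0 < k by omega)
  rcases le_or_gt (k : ℝ) ks with hle | hlt
  · -- inside the anchor's reach: `B log k + C ≤ β`
    have h1 : Real.log k ≤ (β - C) / B := by
      have := Real.log_le_log hk0 hle
      simpa [hks, Real.log_exp] using this
    have h2 : B * Real.log k ≤ B * ((β - C) / B) := mul_le_mul_of_nonneg_left h1 hB.le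
    have h3 : B * ((β - C) / B) = β - C := by field_simp
    have hlog : B * Real.log k + C ≤ β := by linarith
    have hA := anchor k hk β hlog
    refine mono k β (c / k) _ ?_ hA
    calc min m (c / ks) ≤ c / ks := min_le_right _ _
      _ ≤ c / k := div_le_div_of_nonneg_left hc.le hk0 hle
  · -- beyond the crossover scale
    have hθk : θ * ks ≤ k := by
      have : θ * ks ≤ ks := by
        have := mul_le_mul_of_nonneg_right hθ1 hks0.le
        simpa using this
      exact this.trans hlt.le
    exact mono k β m _ (min_le_left _ _) (hbey k hk hθk)

/-! ## §2  The harvest inequality (card A, first lemma; elaboration only) -/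

open MeasureTheory in
/-- **Harvest inequality.** For a probability measure `μ`, a sub-σ-algebra `m` (the EXTERIOR of a
window box) and a bounded observable `f` (a cell-local observable deep inside the box): if `f`
has covariance at most `δ` against EVERY `m`-measurable `g` with `|g| ≤ 2‖f‖∞` (strong clustering
against the whole exterior σ-algebra — the currency of stub `DialThreshold`), then the conditional
expectation `μ[f|m]` has variance at most `δ`. (Proof, not formalised here: `h := μ[f|m] − μ f` is
`m`-measurable, `|h| ≤ 2‖f‖∞` a.e., and `∫ h² = Cov(f,h)`.) -/
def HarvestInequality : Prop :=
  ∀ (Ω : Type) [MeasurableSpace Ω] (m : MeasurableSpace Ω) (μ : Measure Ω) [IsProbabilityMeasure μ]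
    (f : Ω → ℝ) (b δ : ℝ),
    m ≤ ‹MeasurableSpace Ω› → Measurable f → (∀ ω, |f ω| ≤ b) →
    (∀ g : Ω → ℝ, Measurable[m] g → (∀ ω, |g ω| ≤ 2 * b) →
        |∫ ω, f ω * g ω ∂μ - (∫ ω, f ω ∂μ) * ∫ ω, g ω ∂μ| ≤ δ) →
    ∫ ω, (μ[f|m] ω - ∫ ω', f ω' ∂μ) ^ 2 ∂μ ≤ δ

/-! ## §3  Typical insensitivity (the Chebyshev form consumed by a typical-window engine) -/

open MeasureTheory in
/-- **Typical insensitivity of the exterior.** Same data; conclusion in the form a typical-window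
engine consumes: the set of sample points whose exterior datum moves the conditional expectation
of `f` by more than `ε` has probability at most `δ / ε²`. Together with §2 this is
"strong clustering at one scale ⇒ the window inequality holds for TYPICAL exterior data"
(typical under the clustering state itself — the upgrade to all small-field data is the separate,
G-blind stub `MixingUpgrade` of the card). -/
def TypicalInsensitivity : Prop :=
  ∀ (Ω : Type) [MeasurableSpace Ω] (m : MeasurableSpace Ω) (μ : Measure Ω) [IsProbabilityMeasure μ]
    (f : Ω → ℝ) (b δ ε : ℝ),
    m ≤ ‹MeasurableSpace Ω› → Measurable f → (∀ ω, |f ω| ≤ b) → 0 < ε →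
    (∀ g : Ω → ℝ, Measurable[m] g → (∀ ω, |g ω| ≤ 2 * b) →
        |∫ ω, f ω * g ω ∂μ - (∫ ω, f ω ∂μ) * ∫ ω, g ω ∂μ| ≤ δ) →
    μ.real {ω | ε ≤ |μ[f|m] ω - ∫ ω', f ω' ∂μ|} ≤ δ / ε ^ 2

end Summit.QuantumFields.YangMills.Cruxes.CurvatureUniformity.IdeateR1K1
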